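import Literature.NumberTheory.LFunctions.Zhang2022.DetectorShiftAdmissible
import Mathlib.Analysis.Convex.SpecificFunctions.Deriv

/-!
# Zhang (2022), programme F-S3 (cell landau-siegel §E, seat ls-barrier-num): the SIGN of the AFE-plane Gram
# determinant factor `Q(b₀)Q(b₂−b₁) − Q(b₁)Q(b₂−b₀)` (`Q(x) = sin(πx)/x`) on the sign-admissible gaps

Y. Zhang, *Discrete mean estimates and the Landau–Siegel zero*, arXiv:2211.02515v1 [Zhang2022LandauSiegel] —
an unrefereed manuscript under adjudication. **WHAT THIS IS NOT: not a claim about Theorems 1–2 of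
arXiv:2211.02515, about Landau–Siegel zeros, or about Parity; nothing here asserts any claim of the manuscript.
The programme SEARCHES and TYPES; no claim about Landau–Siegel zeros, Theorems 1–2 of arXiv:2211.02515 or a
repaired Margin232 until a kernel theorem says so.**

Context (cell memo barrier/num/H-CLOSED-FORM.md §0–§3, §8). For the shift-triple recipe `Det.shiftRecipe b` the
2×2 Gram matrix `C(b)` of the polar one-sided main-term form on the AFE plane `E_b` has (Id-2, an EXACT
computer-algebra identity, two lineages; NOT yet a kernel theorem)
`det C(b) = (16/b₂)·c₀(b)²·(b₁−b₀)(b₂−b₀)²(b₂−b₁)²·[Q(b₀)Q(b₂−b₁) − Q(b₁)Q(b₂−b₀)]`, `Q(x) = sin(πx)/x`,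
`c₀(b) = Re Σ_j W_j(b) > 0` (`Det.re_sum_shiftW_pos`, `DetectorShiftLeadingCoeff`). The index argument of that memo
(«one kernel anchor per gap settles `Det.FormDetPSD (shiftRecipe b)` on the whole gap») needs `det C(b) ≠ 0` on
each sign-admissible gap region off three edges. THIS FILE proves the trigonometric half of that input — the sign
of the bracket — as a kernel theorem:

* `sin_pi_mul_ge` — `πx(1−x) ≤ sin(πx)` on `[0,1]` (chord of the concave `cos` + monotonicity);
* `sinc_strictAntiOn` — `x ↦ sin(πx)/x` strictly decreasing on `(0,1)` (`x < tan x`);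
* **`gramSign_pos`** — for `0 < b₀ < b₁ < b₂`, `b₀ ≤ 1`, `k ≤ b₁`, `b₂ ≤ k+1` (the gap-`k` cell of
  `Det.SignAdmissible`) and `b` OFF the three edges `{b₁ = k, b₂ = k+1}`, `{b₀ = 1, b₁ = k}`, `{b₀ = 1, b₂ = k+1}`:
  `0 < Q(b₀)Q(b₂−b₁) − Q(b₁)Q(b₂−b₀)`;
* `gramSign_nonneg` — `≥ 0` on the closed gap cell (edges included); `gramSign_std` — `= 0` at `(1,2,3)`
  (the printed detector: `C(1,2,3) = 0`, the tree's one-sided kernel).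

Elementary real analysis; standard axioms; no numerics.
References: Y. Zhang, arXiv:2211.02515v1 (2022), §2 Lemma 2.3, (2.13) [p. 9]; Prop. 7.1 and (8.11)–(8.23) [pp. 44–50].
[cite: Zhang2022LandauSiegel, §2 Lemma 2.3; Prop 7.1 (8.11)–(8.23)]
-/

noncomputable section

open Real Set

namespace Literature.NumberTheory.LFunctions.Zhang2022

namespace Det

/-! ### Part 1 — two elementary facts about `sin(πx)` -/

/-- Chord inequality for the concave `cos`: `1 − 2x ≤ cos(πx)` on `[0, 1/2]`. [folklore] -/
private theorem one_sub_two_mul_le_cos {x : ℝ} (h0 : 0 ≤ x) (h1 : x ≤ 1 / 2) : 1 - 2 * x ≤ Real.cos (π * x) := by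
  have hc := (strictConcaveOn_cos_Icc).concaveOn
  have h0mem : (0:ℝ) ∈ Icc (-(π / 2)) (π / 2) := ⟨by linarith [Real.pi_pos], by linarith [Real.pi_pos]⟩
  have hpmem : (π / 2 : ℝ) ∈ Icc (-(π / 2)) (π / 2) := ⟨by linarith [Real.pi_pos], le_rfl⟩
  have key := hc.2 h0mem hpmem (show 0 ≤ 1 - 2 * x by linarith) (show 0 ≤ 2 * x by linarith) (by ring)
  simp only [smul_eq_mul, mul_zero, zero_add, Real.cos_zero, mul_one, Real.cos_pi_div_two] at key
  have : (2 * x) * (π / 2) = π * x := by ring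
  rw [this] at key
  linarith

/-- `πx(1−x) ≤ sin(πx)` for `0 ≤ x ≤ 1/2` (the derivative of the difference is `π(cos(πx) − (1−2x)) ≥ 0`). [folklore] -/
private theorem sin_pi_mul_ge_half {x : ℝ} (h0 : 0 ≤ x) (h1 : x ≤ 1 / 2) :
    π * x * (1 - x) ≤ Real.sin (π * x) := by
  let g : ℝ → ℝ := fun x => Real.sin (π * x) - π * x * (1 - x)
  have hder : ∀ x, HasDerivAt g (Real.cos (π * x) * (π * 1) - (π * 1 * (1 - x) + π * x * (0 - 1))) x := by
    intro x
    have h1 : HasDerivAt (fun x : ℝ => Real.sin (π * x)) (Real.cos (π * x) * (π * 1)) x :=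
      ((hasDerivAt_id' x).const_mul π).sin
    have h2 : HasDerivAt (fun x : ℝ => π * x * (1 - x)) (π * 1 * (1 - x) + π * x * (0 - 1)) x :=
      ((hasDerivAt_id' x).const_mul π).mul ((hasDerivAt_const x (1:ℝ)).sub (hasDerivAt_id' x))
    exact h1.sub h2
  have hmono : MonotoneOn g (Icc 0 (1 / 2)) := by
    refine monotoneOn_of_deriv_nonneg (convex_Icc 0 (1 / 2)) ?_ ?_ ?_
    · exact fun x _ => (hder x).continuousAt.continuousWithinAt
    · exact fun x _ => (hder x).differentiableAt.differentiableWithinAt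
    · intro x hx
      rw [interior_Icc] at hx
      rw [(hder x).deriv]
      have hc := one_sub_two_mul_le_cos hx.1.le hx.2.le
      have h2 := mul_le_mul_of_nonneg_left hc Real.pi_pos.le
      linarith
  have h := hmono ⟨le_rfl, by norm_num⟩ ⟨h0, h1⟩ h0
  simp only [g, mul_zero, Real.sin_zero, zero_mul, sub_zero] at h
  linarith

/-- **`πx(1−x) ≤ sin(πx)` on `[0,1]`** (symmetry `x ↦ 1−x` for the upper half). [folklore] -/
private theorem sin_pi_mul_ge {x : ℝ} (h0 : 0 ≤ x) (h1 : x ≤ 1) : π * x * (1 - x) ≤ Real.sin (π * x) := by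
  rcases le_or_gt x (1 / 2) with h | h
  · exact sin_pi_mul_ge_half h0 h
  · have h' := sin_pi_mul_ge_half (x := 1 - x) (by linarith) (by linarith)
    rw [show π * (1 - x) = π - π * x by ring, Real.sin_pi_sub] at h'
    linarith [show π * (1 - x) * (1 - (1 - x)) = π * x * (1 - x) by ring]

/-- `sinc` lower bound: `π(1−x) ≤ sin(πx)/x` for `0 < x ≤ 1`. [folklore] -/
private theorem sinc_ge {x : ℝ} (h0 : 0 < x) (h1 : x ≤ 1) : π * (1 - x) ≤ Real.sin (π * x) / x := by
  rw [le_div_iff₀ h0]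
  have := sin_pi_mul_ge h0.le h1
  linarith [show π * x * (1 - x) = π * (1 - x) * x by ring]

/-- `θ·cos θ < sin θ` for `0 < θ < π`. [folklore] -/
private theorem mul_cos_lt_sin' {θ : ℝ} (h0 : 0 < θ) (hπ : θ < π) : θ * Real.cos θ < Real.sin θ := by
  have hsin : 0 < Real.sin θ := Real.sin_pos_of_pos_of_lt_pi h0 hπ
  rcases lt_trichotomy θ (π / 2) with hlt | heq | hgt
  · have hcos : 0 < Real.cos θ := Real.cos_pos_of_mem_Ioo ⟨by linarith, hlt⟩
    have ht := Real.lt_tan h0 hlt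
    rw [Real.tan_eq_sin_div_cos, lt_div_iff₀ hcos] at ht
    exact ht
  · rw [heq, Real.cos_pi_div_two, mul_zero]; exact Real.sin_pi_div_two ▸ one_pos
  · have hcos : Real.cos θ < 0 := Real.cos_neg_of_pi_div_two_lt_of_lt hgt (by linarith)
    nlinarith

/-- **`x ↦ sin(πx)/x` is strictly decreasing on `(0, 1)`.** [folklore] -/
private theorem sinc_strictAntiOn : StrictAntiOn (fun x : ℝ => Real.sin (π * x) / x) (Ioo (0 : ℝ) 1) := by
  have hder : ∀ x ∈ Ioo (0 : ℝ) 1,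
      HasDerivAt (fun x : ℝ => Real.sin (π * x) / x)
        ((Real.cos (π * x) * (π * 1) * x - Real.sin (π * x) * 1) / x ^ 2) x := by
    intro x hx
    exact (((hasDerivAt_id' x).const_mul π).sin).div (hasDerivAt_id' x) (ne_of_gt hx.1)
  refine strictAntiOn_of_deriv_neg (convex_Ioo 0 1) ?_ ?_
  · exact fun x hx => (hder x hx).continuousAt.continuousWithinAt
  · intro x hx
    rw [interior_Ioo] at hx
    rw [(hder x hx).deriv]
    have hθ0 : 0 < π * x := by have := hx.1; positivity
    have hθπ : π * x < π := by have := mul_lt_mul_of_pos_left hx.2 Real.pi_pos; simpa using this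
    have key := mul_cos_lt_sin' hθ0 hθπ
    have hx2 : 0 < x ^ 2 := by have := hx.1; positivity
    apply div_neg_of_neg_of_pos _ hx2
    have e : Real.cos (π * x) * (π * 1) * x - Real.sin (π * x) * 1 = π * x * Real.cos (π * x) - Real.sin (π * x) := by ring
    rw [e]; linarith

/-- `0 ≤ sin(πx)/x` for `0 < x ≤ 1`. [folklore] -/
private theorem sinc_nonneg {x : ℝ} (h0 : 0 < x) (h1 : x ≤ 1) : 0 ≤ Real.sin (π * x) / x :=
  div_nonneg (Real.sin_nonneg_of_nonneg_of_le_pi (by positivity)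
    (by have := mul_le_mul_of_nonneg_left h1 Real.pi_pos.le; simpa using this)) h0.le

/-- `0 < sin(πx)/x` for `0 < x < 1`. [folklore] -/
private theorem sinc_pos {x : ℝ} (h0 : 0 < x) (h1 : x < 1) : 0 < Real.sin (π * x) / x :=
  div_pos (Real.sin_pos_of_pos_of_lt_pi (by positivity)
    (by have := mul_lt_mul_of_pos_left h1 Real.pi_pos; simpa using this)) h0

/-- `sin(πx)/x = 0` iff `x = 1`, for `0 < x ≤ 1`: the `≠ 1` case is positive. [folklore] -/
private theorem sinc_pos_of_ne_one {x : ℝ} (h0 : 0 < x) (h1 : x ≤ 1) (hne : x ≠ 1) :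
    0 < Real.sin (π * x) / x :=
  sinc_pos h0 (lt_of_le_of_ne h1 hne)

/-- `sin(π(k + t)) = (−1)^k sin(πt)`. [folklore] -/
private theorem sin_pi_nat_add (k : ℕ) (t : ℝ) : Real.sin (π * (k + t)) = (-1) ^ k * Real.sin (π * t) := by
  rw [show π * (k + t) = π * t + k * π by ring, Real.sin_add_nat_mul_pi]

/-! ### Part 2 — the sign of the Gram bracket on the gap cells -/

/-- **(I2) of H-CLOSED-FORM.md as a kernel theorem.** On the gap-`k` cell of the sign-admissible set
(`0 < b₀ < b₁ < b₂`, `b₀ ≤ 1`, `k ≤ b₁`, `b₂ ≤ k+1`) and OFF the three edges through the lattice corner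
(`{b₁ = k ∧ b₂ = k+1}`, `{b₀ = 1 ∧ b₁ = k}`, `{b₀ = 1 ∧ b₂ = k+1}`), the bracket
`Q(b₀)Q(b₂−b₁) − Q(b₁)Q(b₂−b₀)`, `Q(x) = sin(πx)/x`, is POSITIVE. Proof: for `k = 0` by monotonicity of `Q`
on `(0,1)`; for `k ≥ 1`, writing `b₁ = k + t`, `b₂ − b₀ = k + τ`, the subtracted product is
`sin(πt)sin(πτ)/(b₁(b₂−b₀))`: if `τ ≤ 0` it is `≤ 0` while `Q(b₀)Q(b₂−b₁) ≥ 0` with equality only on the edges;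
if `τ > 0`, `Q(b₀)Q(b₂−b₁) ≥ π²(1−b₀)(1−(b₂−b₁)) ≥ π²τt > sin(πt)sin(πτ)/(b₁(b₂−b₀))` since `b₁(b₂−b₀) > 1`.
[cite: Zhang2022LandauSiegel, §2 Lemma 2.3; Prop 7.1 (8.11)–(8.23)] -/
theorem gramSign_pos {b : Fin 3 → ℝ} {k : ℕ} (h0 : 0 < b 0) (h01 : b 0 < b 1) (h12 : b 1 < b 2)
    (h1 : b 0 ≤ 1) (hk1 : (k : ℝ) ≤ b 1) (hk2 : b 2 ≤ k + 1)
    (he1 : ¬ (b 1 = k ∧ b 2 = k + 1)) (he2 : ¬ (b 0 = 1 ∧ b 1 = k)) (he3 : ¬ (b 0 = 1 ∧ b 2 = k + 1)) :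
    0 < Real.sin (π * b 0) / b 0 * (Real.sin (π * (b 2 - b 1)) / (b 2 - b 1))
        - Real.sin (π * b 1) / b 1 * (Real.sin (π * (b 2 - b 0)) / (b 2 - b 0)) := by
  have d21 : 0 < b 2 - b 1 := sub_pos.2 h12
  have d20 : 0 < b 2 - b 0 := by linarith
  have hb1 : 0 < b 1 := h0.trans h01
  have hΔle1 : b 2 - b 1 ≤ 1 := by linarith
  -- abbreviations
  set Q0 := Real.sin (π * b 0) / b 0 with hQ0
  set QD := Real.sin (π * (b 2 - b 1)) / (b 2 - b 1) with hQD
  have hQ0nn : 0 ≤ Q0 := sinc_nonneg h0 h1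
  have hQDnn : 0 ≤ QD := sinc_nonneg d21 hΔle1
  rcases Nat.eq_zero_or_pos k with hk0 | hkpos
  · -- k = 0 : everything inside (0,1)
    subst hk0
    have hb2le1 : b 2 ≤ 1 := by simpa using hk2
    have hb1lt1 : b 1 < 1 := lt_of_lt_of_le h12 hb2le1
    have m0 : b 0 ∈ Ioo (0:ℝ) 1 := ⟨h0, by linarith⟩
    have m1 : b 1 ∈ Ioo (0:ℝ) 1 := ⟨hb1, hb1lt1⟩
    have mD : b 2 - b 1 ∈ Ioo (0:ℝ) 1 := ⟨d21, by linarith⟩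
    have mE : b 2 - b 0 ∈ Ioo (0:ℝ) 1 := ⟨d20, by linarith⟩
    have hQ01 : Real.sin (π * b 1) / b 1 < Q0 := sinc_strictAntiOn m0 m1 h01
    have hQDE : Real.sin (π * (b 2 - b 0)) / (b 2 - b 0) < QD := sinc_strictAntiOn mD mE (by linarith)
    have hQ1pos : 0 < Real.sin (π * b 1) / b 1 := sinc_pos hb1 hb1lt1
    have hQEpos : 0 < Real.sin (π * (b 2 - b 0)) / (b 2 - b 0) := sinc_pos d20 (by linarith)
    have hQDpos : 0 < QD := hQEpos.trans hQDE
    have e1 := mul_pos (sub_pos.2 hQ01) hQDpos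
    have e2 := mul_pos hQ1pos (sub_pos.2 hQDE)
    linarith
  · -- k ≥ 1 : write b 1 = k + t, b 2 - b 0 = k + τ
    have hk1' : (1:ℝ) ≤ k := by exact_mod_cast hkpos
    set t := b 1 - k with ht
    set τ := b 2 - b 0 - k with hτ
    have ht0 : 0 ≤ t := by rw [ht]; linarith
    have ht1 : t < 1 := by rw [ht]; linarith
    have hτ1 : τ < 1 := by rw [hτ]; linarith
    have hτm1 : -1 < τ := by rw [hτ]; linarith
    have hs1 : Real.sin (π * b 1) = (-1) ^ k * Real.sin (π * t) := by
      rw [show b 1 = (k:ℝ) + t by rw [ht]; ring, sin_pi_nat_add]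
    have hs2 : Real.sin (π * (b 2 - b 0)) = (-1) ^ k * Real.sin (π * τ) := by
      rw [show b 2 - b 0 = (k:ℝ) + τ by rw [hτ]; ring, sin_pi_nat_add]
    have hsq : ((-1:ℝ) ^ k) * ((-1:ℝ) ^ k) = 1 := by
      rw [← mul_pow]; norm_num
    -- the subtracted product
    have hprod : Real.sin (π * b 1) / b 1 * (Real.sin (π * (b 2 - b 0)) / (b 2 - b 0))
        = Real.sin (π * t) * Real.sin (π * τ) / (b 1 * (b 2 - b 0)) := by
      rw [hs1, hs2, div_mul_div_comm]
      congr 1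
      linear_combination (Real.sin (π * t) * Real.sin (π * τ)) * hsq
    rw [hprod]
    have hden : 0 < b 1 * (b 2 - b 0) := mul_pos hb1 d20
    have hsint : 0 ≤ Real.sin (π * t) :=
      Real.sin_nonneg_of_nonneg_of_le_pi (by positivity)
        (by have := mul_le_mul_of_nonneg_left ht1.le Real.pi_pos.le; simpa using this)
    rcases le_or_gt τ 0 with hτle | hτpos
    · -- τ ≤ 0: subtracted product ≤ 0; the leading product is > 0 unless on an edge
      have hsinτ : Real.sin (π * τ) ≤ 0 :=
        Real.sin_nonpos_of_nonpos_of_neg_pi_le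
          (by have := mul_le_mul_of_nonneg_left hτle Real.pi_pos.le; simpa using this)
          (by have := mul_le_mul_of_nonneg_left hτm1.le Real.pi_pos.le; linarith)
      have hsub : Real.sin (π * t) * Real.sin (π * τ) / (b 1 * (b 2 - b 0)) ≤ 0 :=
        div_nonpos_of_nonpos_of_nonneg (mul_nonpos_of_nonneg_of_nonpos hsint hsinτ) hden.le
      -- is the leading product positive?
      by_cases hb0 : b 0 = 1
      · -- then t > 0 and τ < 0 strictly (edges excluded), so the subtracted product is < 0
        have htpos : 0 < t := by
          rcases lt_or_eq_of_le ht0 with h | h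
          · exact h
          · exact absurd ⟨hb0, by rw [ht] at h; linarith⟩ he2
        have hτne : τ ≠ 0 := by
          intro h; apply he3; refine ⟨hb0, ?_⟩; rw [hτ, hb0] at h; linarith
        have hτneg : τ < 0 := lt_of_le_of_ne hτle hτne
        have hsintp : 0 < Real.sin (π * t) :=
          Real.sin_pos_of_pos_of_lt_pi (mul_pos Real.pi_pos htpos)
            (by have := mul_lt_mul_of_pos_left ht1 Real.pi_pos; simpa using this)
        have hsinτn : Real.sin (π * τ) < 0 :=
          Real.sin_neg_of_neg_of_neg_pi_lt
            (by have := mul_lt_mul_of_pos_left hτneg Real.pi_pos; simpa using this)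
            (by have := mul_lt_mul_of_pos_left hτm1 Real.pi_pos; linarith)
        have : Real.sin (π * t) * Real.sin (π * τ) / (b 1 * (b 2 - b 0)) < 0 :=
          div_neg_of_neg_of_pos (mul_neg_of_pos_of_neg hsintp hsinτn) hden
        have := mul_nonneg hQ0nn hQDnn
        linarith
      · -- b 0 < 1: Q0 > 0; and Δ < 1 (else the lattice edge), so QD > 0
        have hb0lt : b 0 < 1 := lt_of_le_of_ne h1 hb0
        have hQ0p : 0 < Q0 := sinc_pos h0 hb0lt
        have hΔne : b 2 - b 1 ≠ 1 := by
          intro h; apply he1; constructor <;> linarith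
        have hQDp : 0 < QD := sinc_pos_of_ne_one d21 hΔle1 hΔne
        have := mul_pos hQ0p hQDp
        linarith
    · -- τ > 0: Jordan-type lower bound for the leading product, `sin ≤ id` for the subtracted one
      have hb0lt : b 0 < 1 := by rw [hτ] at hτpos; linarith
      have hη : 0 ≤ (k:ℝ) + 1 - b 2 := by linarith
      have hη := mul_nonneg Real.pi_pos.le hη
      have hQ0ge : π * τ ≤ Q0 := by
        have := sinc_ge h0 h1
        have h1b0 : π * (1 - b 0) = π * ((k:ℝ) + 1 - b 2) + π * τ := by rw [hτ]; ring
        rw [h1b0] at this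
        linarith
      have hQDge : π * t ≤ QD := by
        have := sinc_ge d21 hΔle1
        have h1D : π * (1 - (b 2 - b 1)) = π * t + π * ((k:ℝ) + 1 - b 2) := by rw [ht]; ring
        rw [h1D] at this
        linarith
      have hlead : π ^ 2 * (t * τ) ≤ Q0 * QD := by
        have := mul_le_mul hQ0ge hQDge (by positivity) hQ0nn
        calc π ^ 2 * (t * τ) = π * τ * (π * t) := by ring
          _ ≤ Q0 * QD := this
      have hsub_le : Real.sin (π * t) * Real.sin (π * τ) ≤ π ^ 2 * (t * τ) := by
        have h1' : Real.sin (π * t) ≤ π * t := Real.sin_le (by positivity)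
        have h2' : Real.sin (π * τ) ≤ π * τ := Real.sin_le (by positivity)
        have h2p : 0 ≤ Real.sin (π * τ) :=
          Real.sin_nonneg_of_nonneg_of_le_pi (by positivity)
            (by have := mul_le_mul_of_nonneg_left hτ1.le Real.pi_pos.le; simpa using this)
        calc Real.sin (π * t) * Real.sin (π * τ) ≤ (π * t) * (π * τ) :=
              mul_le_mul h1' h2' h2p (by positivity)
          _ = π ^ 2 * (t * τ) := by ring
      have hdengt : 1 < b 1 * (b 2 - b 0) := by
        have hb1ge : 1 ≤ b 1 := hk1'.trans hk1
        have hEgt : 1 < b 2 - b 0 := by rw [hτ] at hτpos; linarith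
        exact one_lt_mul_of_le_of_lt hb1ge hEgt
      rcases lt_or_eq_of_le ht0 with htpos | ht00
      · -- t > 0, τ > 0: strict
        have hpos : 0 < π ^ 2 * (t * τ) := by positivity
        have hfrac : Real.sin (π * t) * Real.sin (π * τ) / (b 1 * (b 2 - b 0)) < π ^ 2 * (t * τ) := by
          rw [div_lt_iff₀ hden]
          calc Real.sin (π * t) * Real.sin (π * τ) ≤ π ^ 2 * (t * τ) := hsub_le
            _ = π ^ 2 * (t * τ) * 1 := (mul_one _).symm
            _ < π ^ 2 * (t * τ) * (b 1 * (b 2 - b 0)) := mul_lt_mul_of_pos_left hdengt hpos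
        linarith
      · -- t = 0: subtracted product vanishes; leading product positive (off the edges)
        have hs0 : Real.sin (π * t) = 0 := by rw [← ht00]; simp
        rw [hs0, zero_mul, zero_div, sub_zero]
        have hQ0p : 0 < Q0 := sinc_pos h0 hb0lt
        have hΔne : b 2 - b 1 ≠ 1 := by
          intro h; apply he1; constructor <;> linarith
        exact mul_pos hQ0p (sinc_pos_of_ne_one d21 hΔle1 hΔne)

/-- **The bracket is `≥ 0` on the CLOSED gap cell** (edges included). [cite: Zhang2022LandauSiegel, §2 Lemma 2.3; Prop 7.1 (8.11)–(8.23)] -/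
theorem gramSign_nonneg {b : Fin 3 → ℝ} {k : ℕ} (h0 : 0 < b 0) (h01 : b 0 < b 1) (h12 : b 1 < b 2)
    (h1 : b 0 ≤ 1) (hk1 : (k : ℝ) ≤ b 1) (hk2 : b 2 ≤ k + 1) :
    0 ≤ Real.sin (π * b 0) / b 0 * (Real.sin (π * (b 2 - b 1)) / (b 2 - b 1))
        - Real.sin (π * b 1) / b 1 * (Real.sin (π * (b 2 - b 0)) / (b 2 - b 0)) := by
  have d21 : 0 < b 2 - b 1 := sub_pos.2 h12
  have d20 : 0 < b 2 - b 0 := by linarith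
  have hb1 : 0 < b 1 := h0.trans h01
  have hQ0nn : 0 ≤ Real.sin (π * b 0) / b 0 := sinc_nonneg h0 h1
  have hQDnn : 0 ≤ Real.sin (π * (b 2 - b 1)) / (b 2 - b 1) := sinc_nonneg d21 (by linarith)
  rcases Nat.eq_zero_or_pos k with hk0 | hkpos
  · subst hk0
    have hb2le1 : b 2 ≤ 1 := by simpa using hk2
    have m0 : b 0 ∈ Ioo (0:ℝ) 1 := ⟨h0, by linarith⟩
    have m1 : b 1 ∈ Ioo (0:ℝ) 1 := ⟨hb1, by linarith⟩
    have mD : b 2 - b 1 ∈ Ioo (0:ℝ) 1 := ⟨d21, by linarith⟩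
    have mE : b 2 - b 0 ∈ Ioo (0:ℝ) 1 := ⟨d20, by linarith⟩
    have hQ01 := sinc_strictAntiOn m0 m1 h01
    have hQDE := sinc_strictAntiOn mD mE (by linarith)
    have hQ1pos : 0 < Real.sin (π * b 1) / b 1 := sinc_pos hb1 (by linarith)
    have hQEpos : 0 < Real.sin (π * (b 2 - b 0)) / (b 2 - b 0) := sinc_pos d20 (by linarith)
    simp only at hQ01 hQDE
    have e1 := mul_pos (sub_pos.2 hQ01) (hQEpos.trans hQDE)
    have e2 := mul_pos hQ1pos (sub_pos.2 hQDE)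
    linarith
  · have hk1' : (1:ℝ) ≤ k := by exact_mod_cast hkpos
    set t := b 1 - k with ht
    set τ := b 2 - b 0 - k with hτ
    have ht0 : 0 ≤ t := by rw [ht]; linarith
    have hs1 : Real.sin (π * b 1) = (-1) ^ k * Real.sin (π * t) := by
      rw [show b 1 = (k:ℝ) + t by rw [ht]; ring, sin_pi_nat_add]
    have hs2 : Real.sin (π * (b 2 - b 0)) = (-1) ^ k * Real.sin (π * τ) := by
      rw [show b 2 - b 0 = (k:ℝ) + τ by rw [hτ]; ring, sin_pi_nat_add]
    have hsq : ((-1:ℝ) ^ k) * ((-1:ℝ) ^ k) = 1 := by rw [← mul_pow]; norm_num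
    have hprod : Real.sin (π * b 1) / b 1 * (Real.sin (π * (b 2 - b 0)) / (b 2 - b 0))
        = Real.sin (π * t) * Real.sin (π * τ) / (b 1 * (b 2 - b 0)) := by
      rw [hs1, hs2, div_mul_div_comm]
      congr 1
      linear_combination (Real.sin (π * t) * Real.sin (π * τ)) * hsq
    rw [hprod]
    have hden : 0 < b 1 * (b 2 - b 0) := mul_pos hb1 d20
    have ht1 : t < 1 := by rw [ht]; linarith
    have hτ1 : τ < 1 := by rw [hτ]; linarith
    have hτm1 : -1 < τ := by rw [hτ]; linarith
    have hsint : 0 ≤ Real.sin (π * t) :=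
      Real.sin_nonneg_of_nonneg_of_le_pi (by positivity)
        (by have := mul_le_mul_of_nonneg_left ht1.le Real.pi_pos.le; simpa using this)
    rcases le_or_gt τ 0 with hτle | hτpos
    · have hsinτ : Real.sin (π * τ) ≤ 0 :=
        Real.sin_nonpos_of_nonpos_of_neg_pi_le
          (by have := mul_le_mul_of_nonneg_left hτle Real.pi_pos.le; simpa using this)
          (by have := mul_le_mul_of_nonneg_left hτm1.le Real.pi_pos.le; linarith)
      have hsub : Real.sin (π * t) * Real.sin (π * τ) / (b 1 * (b 2 - b 0)) ≤ 0 :=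
        div_nonpos_of_nonpos_of_nonneg (mul_nonpos_of_nonneg_of_nonpos hsint hsinτ) hden.le
      have := mul_nonneg hQ0nn hQDnn
      linarith
    · have hη : 0 ≤ π * ((k:ℝ) + 1 - b 2) := mul_nonneg Real.pi_pos.le (by linarith)
      have hQ0ge : π * τ ≤ Real.sin (π * b 0) / b 0 := by
        have := sinc_ge h0 h1
        have h1b0 : π * (1 - b 0) = π * ((k:ℝ) + 1 - b 2) + π * τ := by rw [hτ]; ring
        rw [h1b0] at this
        linarith
      have hQDge : π * t ≤ Real.sin (π * (b 2 - b 1)) / (b 2 - b 1) := by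
        have := sinc_ge d21 (show b 2 - b 1 ≤ 1 by linarith)
        have h1D : π * (1 - (b 2 - b 1)) = π * t + π * ((k:ℝ) + 1 - b 2) := by rw [ht]; ring
        rw [h1D] at this
        linarith
      have hlead : π ^ 2 * (t * τ) ≤ Real.sin (π * b 0) / b 0 * (Real.sin (π * (b 2 - b 1)) / (b 2 - b 1)) := by
        have := mul_le_mul hQ0ge hQDge (by positivity) hQ0nn
        calc π ^ 2 * (t * τ) = π * τ * (π * t) := by ring
          _ ≤ _ := this
      have hsub_le : Real.sin (π * t) * Real.sin (π * τ) ≤ π ^ 2 * (t * τ) := by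
        have h1' : Real.sin (π * t) ≤ π * t := Real.sin_le (by positivity)
        have h2' : Real.sin (π * τ) ≤ π * τ := Real.sin_le (by positivity)
        have h2p : 0 ≤ Real.sin (π * τ) :=
          Real.sin_nonneg_of_nonneg_of_le_pi (by positivity)
            (by have := mul_le_mul_of_nonneg_left hτ1.le Real.pi_pos.le; simpa using this)
        calc Real.sin (π * t) * Real.sin (π * τ) ≤ (π * t) * (π * τ) :=
              mul_le_mul h1' h2' h2p (by positivity)
          _ = π ^ 2 * (t * τ) := by ring
      have hdenge : 1 ≤ b 1 * (b 2 - b 0) := by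
        have hb1ge : 1 ≤ b 1 := hk1'.trans hk1
        have hEge : 1 ≤ b 2 - b 0 := by rw [hτ] at hτpos; linarith
        exact one_le_mul_of_one_le_of_one_le hb1ge hEge
      have hfrac : Real.sin (π * t) * Real.sin (π * τ) / (b 1 * (b 2 - b 0)) ≤ π ^ 2 * (t * τ) := by
        rw [div_le_iff₀ hden]
        have hpos : 0 ≤ π ^ 2 * (t * τ) := by positivity
        calc Real.sin (π * t) * Real.sin (π * τ) ≤ π ^ 2 * (t * τ) := hsub_le
          _ = π ^ 2 * (t * τ) * 1 := (mul_one _).symm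
          _ ≤ π ^ 2 * (t * τ) * (b 1 * (b 2 - b 0)) := mul_le_mul_of_nonneg_left hdenge hpos
      linarith

/-- Control at the printed detector `(1,2,3)`: the bracket VANISHES (`C(1,2,3) = 0`, the tree's one-sided kernel
`mainTermForm_eq_zero_iff_afeSpan`; `(1,2,3)` is the lattice corner of gap `k = 2`). [cite: Zhang2022LandauSiegel, Prop 7.1 p.44] -/
theorem gramSign_std :
    Real.sin (π * (1:ℝ)) / 1 * (Real.sin (π * ((3:ℝ) - 2)) / ((3:ℝ) - 2))
        - Real.sin (π * (2:ℝ)) / 2 * (Real.sin (π * ((3:ℝ) - 1)) / ((3:ℝ) - 1)) = 0 := by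
  have h1 : Real.sin (π * (1:ℝ)) = 0 := by rw [mul_one]; exact Real.sin_pi
  have h2 : Real.sin (π * (2:ℝ)) = 0 := by
    rw [show π * (2:ℝ) = (2:ℕ) * π by push_cast; ring]; exact Real.sin_nat_mul_pi 2
  rw [h1, h2]; simp

end Det

end Literature.NumberTheory.LFunctions.Zhang2022
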